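import Mathlib
import Literature.Analysis.FluidPDE.CKNInterpolationEstimate
import Literature.Analysis.FluidPDE.SpaceTimeRescaling
import Literature.Analysis.FluidPDE.LocalEnergySolutionsRescaling
import Literature.Analysis.FunctionSpaces.SobolevDomainProofs
import Summits.NavierStokesRegularity.NavierStokesRegularity.Theorems.L3TimeExponentPincerPaceDichotomy
import HarnessLib.Audit
import HarnessLib

/-!
# A one-scale localized interpolation inequality: `L³` from a Morrey bound at ONE radius, the energy and the
# dissipation — crux `EffSatBlowup`, line `pace`, stub 2 (route `L3TimeExponentPincer`, item
# `stmt-NavierStokesRegularity-19139`)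

Support file (seat ns-pincer-19139-p1, lead of line `pace`; `--supports stmt-NavierStokesRegularity-19139
--as helper`).  Pure real analysis on `ℝ³`, no Navier–Stokes.

**Theorem (`exists_lintegral_cube_le_of_morrey_oneScale`).**  There is an absolute constant `C₀` such that for every
`C¹` field `f : ℝ³ → ℝ³`, every radius `ρ > 0` and every `M ≥ 0` with the Morrey bound AT THE SINGLE RADIUS `ρ`,
`∫_{B(x,ρ)} |f|² ≤ M ρ` for all centres `x`, one has
`∫ |f|³ ≤ C₀ (Mρ)^{1/2} (∫|f|²)^{1/4} (∫|∇f|² + ρ⁻² ∫|f|²)^{3/4}`.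

Why the line needs it (stub 2 = `stub_morreyTypeI_slow`: Morrey-Type-I frame blow-ups are `L³`-slow): the pace-line
class `MorreyTypeINear` bounds `∫_{B(x,r)}|u(t)|²` only for radii `r > √(T-t)` (top windows), so the tree's slice
inequality `lintegral_cube_sq_le_of_morrey` (nsreg-p4, p435066), which needs the Morrey bound at ALL small radii,
does not apply on that class («MTI not reached by the splitting argument — scales `ρ < √(T-t)` missing», nsreg-p4
g4 census).  Here the sub-`ρ` scales are handled by the GRADIENT instead: on each ball of radius `ρ` the Sobolev
inequality `H¹(B_ρ) ⊂ L⁶(B_ρ)` in scale-invariant form (from the tree's unit-ball embedding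
`exists_eLpNorm_six_le_unitBall`, transported by `y ↦ x + ρy`) and Lebesgue interpolation give
`∫_{B(x,ρ)}|f|³ ≤ C₁ e(x)^{3/4} (d(x) + ρ⁻² e(x))^{3/4}` (`e`, `d` the local energy and dissipation); averaging
over all centres `x` (Fubini: every point is covered by the centres of a ball of volume `|B_ρ|`), using
`e(x) ≤ Mρ` on ONE factor `e^{1/2}` and Hölder `(4, 4/3)` in the centre variable gives the claim — the localization
gains the factor `(Mρ/∫|f|²)^{1/2}` over the global interpolation.  Consequence for the line (companion file
`L3TimeExponentPincerMorreyTypeIDissipationPace.lean`): at a time `t` of a Morrey-Type-I frame solution, with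
`ρ = 2√(T-t)`, `‖u(t)‖₃³ ≲ (T-t)^{1/4} (‖∇u(t)‖₂² + E₀/(T-t))^{3/4}`, so **Type-I dissipation
`‖∇u(t)‖₂² ≲ (T-t)⁻¹` implies the `L³`-Type-I pace of stub 2**.

Contents: §1 Fubini over centres (`lintegral_lintegral_ball_eq`); §2 the scale-invariant Sobolev–interpolation
inequality on a ball (`exists_lintegral_ball_cube_le`); §3 the theorem.

WHAT THIS IS NOT: not a statement about Navier–Stokes; an elementary inequality (Sobolev on balls + Hölder), kernel-
checked, landed `--supports`; the crux `EffSatBlowup` and stubs 2–3 of line `pace` stay open.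

References: L. Caffarelli, R. Kohn, L. Nirenberg, CPAM 35 (1982), §2 (2.8)–(2.10) [CaffarelliKohnNirenberg1982];
J. C. Robinson, J. L. Rodrigo, W. Sadowski, *The three-dimensional Navier–Stokes equations* (2016), Thm 1.7,
Lemma 3.5, Lemma 15.10 [RobinsonRodrigoSadowski2016].
-/

noncomputable section

open MeasureTheory Set Function Filter Metric Topology TopologicalSpace
open scoped ENNReal NNReal Topology
open Literature.Analysis.FluidPDE
open Literature.Analysis

namespace Summit.NavierStokesRegularity.NavierStokesRegularity.Theorems.L3TimeExponentPincerMorreyOneScaleSlice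

/-! ## §1  Fubini over the centres of balls of a fixed radius -/

/-- **Averaging over centres.**  For `g ≥ 0` measurable and `ρ > 0`:
`∫_z ∫_{B(z,ρ)} g = |B_ρ| ∫ g` (Tonelli; every point `y` is seen by the centres `z ∈ B(y,ρ)`). [folklore] -/
theorem lintegral_lintegral_ball_eq {g : EuclideanSpace ℝ (Fin 3) → ℝ≥0∞} (hg : AEMeasurable g volume) (ρ : ℝ) :
    ∫⁻ z, ∫⁻ y in ball z ρ, g y = volume (ball (0 : EuclideanSpace ℝ (Fin 3)) ρ) * ∫⁻ y, g y := by
  set Φ : EuclideanSpace ℝ (Fin 3) → EuclideanSpace ℝ (Fin 3) → ℝ≥0∞ :=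
    fun z y => (ball z ρ).indicator g y with hΦ
  have hΦm : AEMeasurable (uncurry Φ) (volume.prod volume) := by
    have e : uncurry Φ =
        {p : EuclideanSpace ℝ (Fin 3) × EuclideanSpace ℝ (Fin 3) | dist p.2 p.1 < ρ}.indicator
          fun p => g p.2 := by
      funext p
      simp only [hΦ, uncurry, indicator, mem_ball, mem_setOf_eq]
    rw [e]
    refine hg.comp_snd.indicator ?_
    exact (isOpen_lt (continuous_snd.dist continuous_fst) continuous_const).measurableSet
  have h1 : ∀ z, ∫⁻ y in ball z ρ, g y = ∫⁻ y, Φ z y := fun z => by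
    rw [hΦ, lintegral_indicator measurableSet_ball]
  have h2 : ∀ y, ∫⁻ z, Φ z y = volume (ball (0 : EuclideanSpace ℝ (Fin 3)) ρ) * g y := fun y => by
    have e : (fun z => Φ z y) = (ball y ρ).indicator fun _ => g y := by
      funext z
      simp only [hΦ, indicator, mem_ball]
      rw [dist_comm]
    rw [e, lintegral_indicator measurableSet_ball, setLIntegral_const, Measure.addHaar_ball_center volume y ρ,
      mul_comm]
  calc ∫⁻ z, ∫⁻ y in ball z ρ, g y = ∫⁻ z, ∫⁻ y, Φ z y := lintegral_congr h1
    _ = ∫⁻ y, ∫⁻ z, Φ z y := lintegral_lintegral_swap hΦm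
    _ = ∫⁻ y, volume (ball (0 : EuclideanSpace ℝ (Fin 3)) ρ) * g y := lintegral_congr h2
    _ = volume (ball (0 : EuclideanSpace ℝ (Fin 3)) ρ) * ∫⁻ y, g y := lintegral_const_mul'' _ hg

/-- Measurability of the local mass `z ↦ ∫_{B(z,ρ)} g`. [folklore] -/
theorem measurable_lintegral_ball {g : EuclideanSpace ℝ (Fin 3) → ℝ≥0∞} (hg : Measurable g) (ρ : ℝ) :
    Measurable fun z : EuclideanSpace ℝ (Fin 3) => ∫⁻ y in ball z ρ, g y := by
  set Φ : EuclideanSpace ℝ (Fin 3) → EuclideanSpace ℝ (Fin 3) → ℝ≥0∞ :=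
    fun z y => (ball z ρ).indicator g y with hΦ
  have hΦm : Measurable (uncurry Φ) := by
    have e : uncurry Φ =
        {p : EuclideanSpace ℝ (Fin 3) × EuclideanSpace ℝ (Fin 3) | dist p.2 p.1 < ρ}.indicator
          fun p => g p.2 := by
      funext p
      simp only [hΦ, uncurry, indicator, mem_ball, mem_setOf_eq]
    rw [e]
    refine (hg.comp measurable_snd).indicator ?_
    exact (isOpen_lt (continuous_snd.dist continuous_fst) continuous_const).measurableSet
  have h1 : (fun z : EuclideanSpace ℝ (Fin 3) => ∫⁻ y in ball z ρ, g y) = fun z => ∫⁻ y, Φ z y := by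
    funext z
    rw [hΦ, lintegral_indicator measurableSet_ball]
  rw [h1]
  exact hΦm.lintegral_prod_right'

/-! ## §2  The scale-invariant Sobolev–interpolation inequality on one ball -/

/-- Change of variables on a ball: `∫_{B(0,1)} F(x + ρy) dy = ρ⁻³ ∫_{B(x,ρ)} F`. [folklore] -/
theorem lintegral_unitBall_comp_affine {ρ : ℝ} (hρ : 0 < ρ) (x : EuclideanSpace ℝ (Fin 3))
    (F : EuclideanSpace ℝ (Fin 3) → ℝ≥0∞) :
    ∫⁻ y in ball (0 : EuclideanSpace ℝ (Fin 3)) 1, F (x + ρ • y) =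
      ENNReal.ofReal (ρ ^ 3)⁻¹ * ∫⁻ y in ball x ρ, F y := by
  have e : ball (0 : EuclideanSpace ℝ (Fin 3)) 1 =
      (fun y : EuclideanSpace ℝ (Fin 3) => x + ρ • y) ⁻¹' ball (x + ρ • (0 : EuclideanSpace ℝ (Fin 3))) (ρ * 1) :=
    (space_affine_preimage_ball_add_smul hρ x 0 1).symm
  rw [e, setLIntegral_preimage_comp_space_affine hρ x F, finrank_euclideanSpace_fin, smul_zero, add_zero,
    mul_one]

/-- `a^{1/2} + b^{1/2} ≤ 2 (a + b)^{1/2}` in `ℝ≥0∞`. [folklore] -/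
theorem rpow_half_add_rpow_half_le (a b : ℝ≥0∞) :
    a ^ (1 / 2 : ℝ) + b ^ (1 / 2 : ℝ) ≤ 2 * (a + b) ^ (1 / 2 : ℝ) := by
  rw [two_mul]
  exact add_le_add (ENNReal.rpow_le_rpow le_self_add (by norm_num))
    (ENNReal.rpow_le_rpow le_add_self (by norm_num))

/-- `∫_{B} ‖f‖ₑ²` is finite for a continuous field on a ball. [folklore] -/
theorem setLIntegral_ball_enorm_sq_lt_top {f : EuclideanSpace ℝ (Fin 3) → EuclideanSpace ℝ (Fin 3)}
    (hf : Continuous f) (x : EuclideanSpace ℝ (Fin 3)) (ρ : ℝ) :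
    ∫⁻ y in ball x ρ, ‖f y‖ₑ ^ (2 : ℕ) < ⊤ := by
  obtain ⟨K, hK⟩ := (isCompact_closedBall x ρ).exists_bound_of_continuousOn (hf.norm.continuousOn)
  calc ∫⁻ y in ball x ρ, ‖f y‖ₑ ^ (2 : ℕ) ≤ ∫⁻ _ in ball x ρ, ENNReal.ofReal (K ^ 2) := by
        refine setLIntegral_mono' measurableSet_ball fun y hy => ?_
        have h2 : ‖f y‖ ≤ K := by
          have := hK y (ball_subset_closedBall hy)
          rwa [Real.norm_eq_abs, abs_of_nonneg (norm_nonneg _)] at this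
        calc ‖f y‖ₑ ^ (2 : ℕ) = ENNReal.ofReal (‖f y‖ ^ 2) := by
              rw [← ofReal_norm, ENNReal.ofReal_pow (norm_nonneg _)]
          _ ≤ ENNReal.ofReal (K ^ 2) :=
              ENNReal.ofReal_le_ofReal (pow_le_pow_left₀ (norm_nonneg _) h2 2)
    _ < ⊤ := by
        rw [setLIntegral_const]
        exact ENNReal.mul_lt_top ENNReal.ofReal_lt_top measure_ball_lt_top

/-- The scaling identity `(ρ² · ρ⁻³)^{1/2} = (ρ⁻³)^{1/6}` behind the scale invariance of
`ρ⁻¹‖f‖_{L²(B_ρ)} + ‖∇f‖_{L²(B_ρ)}` versus `‖f‖_{L⁶(B_ρ)}`. [folklore] -/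
theorem scaling_rpow_identity {ρ : ℝ} (hρ : 0 < ρ) :
    (ENNReal.ofReal (ρ ^ 2) * ENNReal.ofReal (ρ ^ 3)⁻¹) ^ (1 / 2 : ℝ) =
      (ENNReal.ofReal (ρ ^ 3)⁻¹) ^ (1 / 6 : ℝ) := by
  have h3 : 0 < ρ ^ 3 := pow_pos hρ 3
  rw [← ENNReal.ofReal_mul (sq_nonneg ρ), ENNReal.ofReal_rpow_of_pos (by positivity),
    ENNReal.ofReal_rpow_of_pos (inv_pos.2 h3)]
  congr 1
  rw [show ρ ^ 2 * (ρ ^ 3)⁻¹ = ρ ^ ((-1 : ℤ) : ℝ) by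
        rw [Real.rpow_intCast, zpow_neg, zpow_one]; field_simp,
      show (ρ ^ 3)⁻¹ = ρ ^ ((-3 : ℤ) : ℝ) by
        rw [Real.rpow_intCast, zpow_neg]; norm_cast,
      ← Real.rpow_mul hρ.le, ← Real.rpow_mul hρ.le]
  norm_num

/-- **Sobolev–interpolation on a ball, scale-invariant form.**  There is an absolute constant `C₁` such that for
every `C¹` field `f : ℝ³ → ℝ³`, every centre `x` and radius `ρ > 0`, with `e = ∫_{B(x,ρ)}|f|²`,
`d = ∫_{B(x,ρ)}|∇f|²` (Frobenius density):  `∫_{B(x,ρ)} |f|³ ≤ C₁ e^{3/4} (d + ρ⁻² e)^{3/4}`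
(`H¹(B_ρ) ⊂ L⁶(B_ρ)` with `‖f‖_{L⁶(B_ρ)} ≤ C(ρ⁻¹‖f‖_{L²(B_ρ)} + ‖∇f‖_{L²(B_ρ)})`, by scaling the unit-ball
embedding, and `‖f‖₃ ≤ ‖f‖₂^{1/2}‖f‖₆^{1/2}`). [cite: RobinsonRodrigoSadowski2016, Thm 1.7 and Lemma 3.5] -/
theorem exists_lintegral_ball_cube_le :
    ∃ C₁ : ℝ≥0, ∀ (f : EuclideanSpace ℝ (Fin 3) → EuclideanSpace ℝ (Fin 3)), ContDiff ℝ 1 f →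
      ∀ (x : EuclideanSpace ℝ (Fin 3)) (ρ : ℝ), 0 < ρ →
        ∫⁻ y in ball x ρ, ‖f y‖ₑ ^ (3 : ℕ) ≤
          C₁ * (∫⁻ y in ball x ρ, ‖f y‖ₑ ^ (2 : ℕ)) ^ (3 / 4 : ℝ) *
            ((∫⁻ y in ball x ρ, ENNReal.ofReal (frobeniusNormSq (fderiv ℝ f y))) +
              (ENNReal.ofReal (ρ ^ 2))⁻¹ * ∫⁻ y in ball x ρ, ‖f y‖ₑ ^ (2 : ℕ)) ^ (3 / 4 : ℝ) := by
  obtain ⟨C, hC⟩ := exists_eLpNorm_six_le_unitBall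
  refine ⟨((2 : ℝ≥0) * C) ^ (3 / 2 : ℝ), fun f hf x ρ hρ => ?_⟩
  set B : Set (EuclideanSpace ℝ (Fin 3)) := ball x ρ with hB
  set e : ℝ≥0∞ := ∫⁻ y in B, ‖f y‖ₑ ^ (2 : ℕ) with he
  set d : ℝ≥0∞ := ∫⁻ y in B, ENNReal.ofReal (frobeniusNormSq (fderiv ℝ f y)) with hd
  set I₆ : ℝ≥0∞ := ∫⁻ y in B, ‖f y‖ₑ ^ (6 : ℝ) with hI₆
  set W : ℝ≥0∞ := d + (ENNReal.ofReal (ρ ^ 2))⁻¹ * e with hW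
  -- ### the rescaled field on the unit ball
  set g : EuclideanSpace ℝ (Fin 3) → EuclideanSpace ℝ (Fin 3) := fun y => f (x + ρ • y) with hg
  have hgC : ContDiff ℝ 1 g := hf.comp ((contDiff_const).add (contDiff_id.const_smul ρ))
  have hfd : ∀ y, fderiv ℝ g y = ρ • fderiv ℝ f (x + ρ • y) := fun y => by
    have h := fderiv_comp_smul (𝕜 := ℝ) (f := fun z => f (x + z)) (x := y) ρ
    rw [fderiv_comp_add_left] at h
    exact h
  have hw : FunctionSpaces.HasWeakFDerivOn
      (⟨ball (0 : EuclideanSpace ℝ (Fin 3)) 1, isOpen_ball⟩ : Opens (EuclideanSpace ℝ (Fin 3))) volume g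
      (fderiv ℝ g) :=
    FunctionSpaces.HasWeakFDerivOn.of_contDiff_holds _ volume hgC
  -- ### change of variables for the three integrals
  have hcv2 : ∫⁻ y in ball (0 : EuclideanSpace ℝ (Fin 3)) 1, ‖g y‖ₑ ^ (2 : ℝ) =
      ENNReal.ofReal (ρ ^ 3)⁻¹ * e := by
    rw [he, lintegral_unitBall_comp_affine hρ x (fun y => ‖f y‖ₑ ^ (2 : ℝ))]
    congr 1
    refine lintegral_congr fun y => ?_
    rw [← ENNReal.rpow_natCast]
    norm_num
  have hcv6 : ∫⁻ y in ball (0 : EuclideanSpace ℝ (Fin 3)) 1, ‖g y‖ₑ ^ (6 : ℝ) =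
      ENNReal.ofReal (ρ ^ 3)⁻¹ * I₆ :=
    lintegral_unitBall_comp_affine hρ x (fun y => ‖f y‖ₑ ^ (6 : ℝ))
  have hcvd : ∫⁻ y in ball (0 : EuclideanSpace ℝ (Fin 3)) 1, ENNReal.ofReal (frobeniusNormSq (fderiv ℝ g y)) =
      ENNReal.ofReal (ρ ^ 2) * (ENNReal.ofReal (ρ ^ 3)⁻¹ * d) := by
    have e1 : ∀ y, ENNReal.ofReal (frobeniusNormSq (fderiv ℝ g y)) =
        ENNReal.ofReal (ρ ^ 2) * ENNReal.ofReal (frobeniusNormSq (fderiv ℝ f (x + ρ • y))) := fun y => by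
      rw [hfd, frobeniusNormSq_smul, ENNReal.ofReal_mul (sq_nonneg _)]
    simp_rw [e1]
    rw [lintegral_const_mul' _ _ ENNReal.ofReal_ne_top,
      lintegral_unitBall_comp_affine hρ x (fun y => ENNReal.ofReal (frobeniusNormSq (fderiv ℝ f y)))]
  -- ### the `eLpNorm`s as integrals
  have hL2 : eLpNorm g 2 (volume.restrict (ball (0 : EuclideanSpace ℝ (Fin 3)) 1)) =
      (ENNReal.ofReal (ρ ^ 3)⁻¹ * e) ^ (1 / 2 : ℝ) := by
    rw [eLpNorm_eq_lintegral_rpow_enorm_toReal two_ne_zero ENNReal.ofNat_ne_top, ENNReal.toReal_ofNat, hcv2]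
  have hL6 : eLpNorm g 6 (volume.restrict (ball (0 : EuclideanSpace ℝ (Fin 3)) 1)) =
      (ENNReal.ofReal (ρ ^ 3)⁻¹ * I₆) ^ (1 / 6 : ℝ) := by
    rw [eLpNorm_eq_lintegral_rpow_enorm_toReal (by norm_num) ENNReal.ofNat_ne_top, ENNReal.toReal_ofNat, hcv6]
  -- finiteness of `e`
  have hetop : e ≠ ⊤ := (setLIntegral_ball_enorm_sq_lt_top hf.continuous x ρ).ne
  have hg2 : eLpNorm g 2 (volume.restrict (ball (0 : EuclideanSpace ℝ (Fin 3)) 1)) ≠ ⊤ := by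
    rw [hL2]
    exact ENNReal.rpow_ne_top_of_nonneg (by norm_num) (ENNReal.mul_ne_top ENNReal.ofReal_ne_top hetop)
  -- ### Sobolev on the unit ball, transported
  have hS := hC g (fderiv ℝ g) hw hg2
  rw [hL6, hL2, hcvd] at hS
  -- both terms on the right are `≤ (ρ² ρ⁻³ W)^{1/2}`
  set a : ℝ≥0∞ := ENNReal.ofReal (ρ ^ 3)⁻¹ with ha
  have ha0 : a ≠ 0 := (ENNReal.ofReal_pos.2 (inv_pos.2 (pow_pos hρ 3))).ne'
  have hat : a ≠ ⊤ := ENNReal.ofReal_ne_top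
  have hρ2 : ENNReal.ofReal (ρ ^ 2) ≠ 0 := (ENNReal.ofReal_pos.2 (pow_pos hρ 2)).ne'
  have hkey : ENNReal.ofReal (ρ ^ 2) * a * W = ENNReal.ofReal (ρ ^ 2) * (a * d) + a * e := by
    rw [hW, mul_add, ← mul_assoc, ← mul_assoc, mul_comm (ENNReal.ofReal (ρ ^ 2) * a) ((ENNReal.ofReal (ρ ^ 2))⁻¹),
      ← mul_assoc, ENNReal.inv_mul_cancel hρ2 ENNReal.ofReal_ne_top, one_mul]
  have hsum : (a * e) ^ (1 / 2 : ℝ) + (ENNReal.ofReal (ρ ^ 2) * (a * d)) ^ (1 / 2 : ℝ) ≤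
      2 * (ENNReal.ofReal (ρ ^ 2) * a * W) ^ (1 / 2 : ℝ) := by
    rw [hkey, add_comm (ENNReal.ofReal (ρ ^ 2) * (a * d)) (a * e)]
    exact rpow_half_add_rpow_half_le _ _
  have hS2 : (a * I₆) ^ (1 / 6 : ℝ) ≤ C * (2 * (ENNReal.ofReal (ρ ^ 2) * a * W) ^ (1 / 2 : ℝ)) :=
    hS.trans (mul_le_mul' le_rfl hsum)
  -- cancel the common scaling factor `a^{1/6} = (ρ² a)^{1/2}`
  rw [ENNReal.mul_rpow_of_nonneg _ _ (by norm_num : (0 : ℝ) ≤ 1 / 6),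
    ENNReal.mul_rpow_of_nonneg _ _ (by norm_num : (0 : ℝ) ≤ 1 / 2), ha, scaling_rpow_identity hρ, ← ha] at hS2
  have hc0 : a ^ (1 / 6 : ℝ) ≠ 0 := (ENNReal.rpow_pos (pos_iff_ne_zero.2 ha0) hat).ne'
  have hct : a ^ (1 / 6 : ℝ) ≠ ⊤ := ENNReal.rpow_ne_top_of_nonneg (by norm_num) hat
  have hS3 : I₆ ^ (1 / 6 : ℝ) ≤ (2 * C : ℝ≥0∞) * W ^ (1 / 2 : ℝ) := by
    have h1 : a ^ (1 / 6 : ℝ) * I₆ ^ (1 / 6 : ℝ) ≤ a ^ (1 / 6 : ℝ) * ((2 * C : ℝ≥0∞) * W ^ (1 / 2 : ℝ)) := by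
      calc a ^ (1 / 6 : ℝ) * I₆ ^ (1 / 6 : ℝ) ≤ C * (2 * (a ^ (1 / 6 : ℝ) * W ^ (1 / 2 : ℝ))) := hS2
        _ = a ^ (1 / 6 : ℝ) * ((2 * C : ℝ≥0∞) * W ^ (1 / 2 : ℝ)) := by ring
    exact (ENNReal.mul_le_mul_iff_right hc0 hct).1 h1
  -- raise to the power `3/2`
  have hS4 : I₆ ^ (1 / 4 : ℝ) ≤ (((2 : ℝ≥0) * C) ^ (3 / 2 : ℝ) : ℝ≥0) * W ^ (3 / 4 : ℝ) := by
    have h1 := ENNReal.rpow_le_rpow hS3 (by norm_num : (0 : ℝ) ≤ 3 / 2)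
    rw [← ENNReal.rpow_mul, ENNReal.mul_rpow_of_nonneg _ _ (by norm_num : (0 : ℝ) ≤ 3 / 2), ← ENNReal.rpow_mul,
      show (1 / 6 : ℝ) * (3 / 2) = 1 / 4 by norm_num, show (1 / 2 : ℝ) * (3 / 2) = 3 / 4 by norm_num] at h1
    refine h1.trans (le_of_eq ?_)
    congr 1
    rw [ENNReal.coe_rpow_of_nonneg _ (by norm_num : (0 : ℝ) ≤ 3 / 2)]
    push_cast
    rfl
  -- ### Lebesgue interpolation and assembly
  have hmeas : AEMeasurable (fun y => ‖f y‖ₑ) (volume.restrict B) :=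
    hf.continuous.measurable.enorm.aemeasurable
  have hH := lintegral_pow_three_le_Lp_interpolation (volume.restrict B) hmeas
  calc ∫⁻ y in B, ‖f y‖ₑ ^ (3 : ℕ) ≤ e ^ (3 / 4 : ℝ) * I₆ ^ (1 / 4 : ℝ) := hH
    _ ≤ e ^ (3 / 4 : ℝ) * ((((2 : ℝ≥0) * C) ^ (3 / 2 : ℝ) : ℝ≥0) * W ^ (3 / 4 : ℝ)) := by gcongr
    _ = (((2 : ℝ≥0) * C) ^ (3 / 2 : ℝ) : ℝ≥0) * e ^ (3 / 4 : ℝ) * W ^ (3 / 4 : ℝ) := by ring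

/-! ## §3  The one-scale localized interpolation inequality -/

/-- **One-scale localized interpolation.**  There is an absolute constant `C₀` such that for every `C¹` field
`f : ℝ³ → ℝ³`, all `ρ > 0`, `M ≥ 0` with `∫_{B(x,ρ)}|f|² ≤ Mρ` for every centre `x` (Morrey bound at the ONE radius
`ρ`):  `∫|f|³ ≤ C₀ (Mρ)^{1/2} (∫|f|²)^{1/4} (∫|∇f|² + ρ⁻²∫|f|²)^{3/4}`.
Proof: average the ball inequality `exists_lintegral_ball_cube_le` over all centres (`lintegral_lintegral_ball_eq`),
bound one factor `e(x)^{1/2} ≤ (Mρ)^{1/2}`, and use Hölder `(4, 4/3)` in the centre. [cite: CaffarelliKohnNirenberg1982, §2 (2.8)–(2.10)] -/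
theorem exists_lintegral_cube_le_of_morrey_oneScale :
    ∃ C₀ : ℝ≥0, ∀ (f : EuclideanSpace ℝ (Fin 3) → EuclideanSpace ℝ (Fin 3)), ContDiff ℝ 1 f →
      ∀ (ρ M : ℝ), 0 < ρ → 0 ≤ M →
        (∀ x : EuclideanSpace ℝ (Fin 3), ∫⁻ y in ball x ρ, ‖f y‖ₑ ^ (2 : ℕ) ≤ ENNReal.ofReal (M * ρ)) →
        ∫⁻ y, ‖f y‖ₑ ^ (3 : ℕ) ≤
          C₀ * ENNReal.ofReal (M * ρ) ^ (1 / 2 : ℝ) * (∫⁻ y, ‖f y‖ₑ ^ (2 : ℕ)) ^ (1 / 4 : ℝ) *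
            ((∫⁻ y, ENNReal.ofReal (frobeniusNormSq (fderiv ℝ f y))) +
              (ENNReal.ofReal (ρ ^ 2))⁻¹ * ∫⁻ y, ‖f y‖ₑ ^ (2 : ℕ)) ^ (3 / 4 : ℝ) := by
  obtain ⟨C₁, hC₁⟩ := exists_lintegral_ball_cube_le
  refine ⟨C₁, fun f hf ρ M hρ hM hMor => ?_⟩
  -- notation
  set V : ℝ≥0∞ := volume (ball (0 : EuclideanSpace ℝ (Fin 3)) ρ) with hV
  have hV0 : V ≠ 0 := (measure_ball_pos volume _ hρ).ne'
  have hVt : V ≠ ⊤ := measure_ball_lt_top.ne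
  set E : ℝ≥0∞ := ∫⁻ y, ‖f y‖ₑ ^ (2 : ℕ) with hE
  set D : ℝ≥0∞ := ∫⁻ y, ENNReal.ofReal (frobeniusNormSq (fderiv ℝ f y)) with hD
  set e : EuclideanSpace ℝ (Fin 3) → ℝ≥0∞ := fun z => ∫⁻ y in ball z ρ, ‖f y‖ₑ ^ (2 : ℕ) with he
  set dd : EuclideanSpace ℝ (Fin 3) → ℝ≥0∞ :=
    fun z => ∫⁻ y in ball z ρ, ENNReal.ofReal (frobeniusNormSq (fderiv ℝ f y)) with hdd
  set W : EuclideanSpace ℝ (Fin 3) → ℝ≥0∞ := fun z => dd z + (ENNReal.ofReal (ρ ^ 2))⁻¹ * e z with hW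
  -- measurability
  have hm2 : Measurable fun y => ‖f y‖ₑ ^ (2 : ℕ) := hf.continuous.measurable.enorm.pow_const 2
  have hm3 : Measurable fun y => ‖f y‖ₑ ^ (3 : ℕ) := hf.continuous.measurable.enorm.pow_const 3
  have hmd : Measurable fun y => ENNReal.ofReal (frobeniusNormSq (fderiv ℝ f y)) :=
    (continuous_frobeniusNormSq'.comp (hf.continuous_fderiv one_ne_zero)).measurable.ennreal_ofReal
  have hem : Measurable e := measurable_lintegral_ball hm2 ρ
  have hddm : Measurable dd := measurable_lintegral_ball hmd ρ
  have hWm : Measurable W := hddm.add (hem.const_mul _)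
  -- ### Step 1: averaging over centres
  have h1 : V * ∫⁻ y, ‖f y‖ₑ ^ (3 : ℕ) = ∫⁻ z, ∫⁻ y in ball z ρ, ‖f y‖ₑ ^ (3 : ℕ) :=
    (lintegral_lintegral_ball_eq hm3.aemeasurable ρ).symm
  have hEz : ∫⁻ z, e z = V * E := lintegral_lintegral_ball_eq hm2.aemeasurable ρ
  have hDz : ∫⁻ z, dd z = V * D := lintegral_lintegral_ball_eq hmd.aemeasurable ρ
  have hWz : ∫⁻ z, W z = V * (D + (ENNReal.ofReal (ρ ^ 2))⁻¹ * E) := by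
    rw [hW]
    change ∫⁻ z, (dd z + (ENNReal.ofReal (ρ ^ 2))⁻¹ * e z) = _
    rw [lintegral_add_left hddm, lintegral_const_mul _ hem, hEz, hDz]
    ring
  -- ### Step 2: ball by ball
  have h2 : ∀ z, ∫⁻ y in ball z ρ, ‖f y‖ₑ ^ (3 : ℕ) ≤
      C₁ * ENNReal.ofReal (M * ρ) ^ (1 / 2 : ℝ) * (e z ^ (1 / 4 : ℝ) * W z ^ (3 / 4 : ℝ)) := by
    intro z
    have hb := hC₁ f hf z ρ hρ
    have hsplit : e z ^ (3 / 4 : ℝ) = e z ^ (1 / 2 : ℝ) * e z ^ (1 / 4 : ℝ) := by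
      rw [← ENNReal.rpow_add_of_nonneg _ _ (by norm_num) (by norm_num)]; norm_num
    have hez : e z ^ (1 / 2 : ℝ) ≤ ENNReal.ofReal (M * ρ) ^ (1 / 2 : ℝ) :=
      ENNReal.rpow_le_rpow (hMor z) (by norm_num)
    calc ∫⁻ y in ball z ρ, ‖f y‖ₑ ^ (3 : ℕ) ≤ C₁ * e z ^ (3 / 4 : ℝ) * W z ^ (3 / 4 : ℝ) := hb
      _ = C₁ * e z ^ (1 / 2 : ℝ) * (e z ^ (1 / 4 : ℝ) * W z ^ (3 / 4 : ℝ)) := by rw [hsplit]; ring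
      _ ≤ C₁ * ENNReal.ofReal (M * ρ) ^ (1 / 2 : ℝ) * (e z ^ (1 / 4 : ℝ) * W z ^ (3 / 4 : ℝ)) := by gcongr
  -- ### Step 3: Hölder in the centre variable
  have hpq : (4 : ℝ).HolderConjugate (4 / 3) := Real.holderConjugate_iff.2 ⟨by norm_num, by norm_num⟩
  have h3 : ∫⁻ z, e z ^ (1 / 4 : ℝ) * W z ^ (3 / 4 : ℝ) ≤
      (∫⁻ z, e z) ^ (1 / 4 : ℝ) * (∫⁻ z, W z) ^ (3 / 4 : ℝ) := by
    have key := ENNReal.lintegral_mul_le_Lp_mul_Lq volume hpq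
      ((hem.pow_const (1 / 4 : ℝ)).aemeasurable) ((hWm.pow_const (3 / 4 : ℝ)).aemeasurable)
    have e1 : ∀ z, (e z ^ (1 / 4 : ℝ)) ^ (4 : ℝ) = e z := fun z => by
      rw [← ENNReal.rpow_mul]; norm_num
    have e2 : ∀ z, (W z ^ (3 / 4 : ℝ)) ^ (4 / 3 : ℝ) = W z := fun z => by
      rw [← ENNReal.rpow_mul]; norm_num
    simp only [Pi.mul_apply, e1, e2] at key
    rw [show (1 : ℝ) / 4 = 1 / 4 by norm_num, show (1 : ℝ) / (4 / 3) = 3 / 4 by norm_num] at key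
    exact key
  -- ### Step 4: assembly
  have h4 : V * ∫⁻ y, ‖f y‖ₑ ^ (3 : ℕ) ≤
      V * (C₁ * ENNReal.ofReal (M * ρ) ^ (1 / 2 : ℝ) * E ^ (1 / 4 : ℝ) *
        (D + (ENNReal.ofReal (ρ ^ 2))⁻¹ * E) ^ (3 / 4 : ℝ)) := by
    calc V * ∫⁻ y, ‖f y‖ₑ ^ (3 : ℕ) = ∫⁻ z, ∫⁻ y in ball z ρ, ‖f y‖ₑ ^ (3 : ℕ) := h1
      _ ≤ ∫⁻ z, C₁ * ENNReal.ofReal (M * ρ) ^ (1 / 2 : ℝ) * (e z ^ (1 / 4 : ℝ) * W z ^ (3 / 4 : ℝ)) :=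
          lintegral_mono h2
      _ = C₁ * ENNReal.ofReal (M * ρ) ^ (1 / 2 : ℝ) * ∫⁻ z, e z ^ (1 / 4 : ℝ) * W z ^ (3 / 4 : ℝ) := by
          rw [lintegral_const_mul' _ _ (ENNReal.mul_ne_top ENNReal.coe_ne_top
            (ENNReal.rpow_ne_top_of_nonneg (by norm_num) ENNReal.ofReal_ne_top))]
      _ ≤ C₁ * ENNReal.ofReal (M * ρ) ^ (1 / 2 : ℝ) * ((∫⁻ z, e z) ^ (1 / 4 : ℝ) * (∫⁻ z, W z) ^ (3 / 4 : ℝ)) := by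
          gcongr
      _ = C₁ * ENNReal.ofReal (M * ρ) ^ (1 / 2 : ℝ) *
            ((V * E) ^ (1 / 4 : ℝ) * (V * (D + (ENNReal.ofReal (ρ ^ 2))⁻¹ * E)) ^ (3 / 4 : ℝ)) := by
          rw [hEz, hWz]
      _ = V * (C₁ * ENNReal.ofReal (M * ρ) ^ (1 / 2 : ℝ) * E ^ (1 / 4 : ℝ) *
            (D + (ENNReal.ofReal (ρ ^ 2))⁻¹ * E) ^ (3 / 4 : ℝ)) := by
          rw [ENNReal.mul_rpow_of_nonneg _ _ (by norm_num : (0 : ℝ) ≤ 1 / 4),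
            ENNReal.mul_rpow_of_nonneg _ _ (by norm_num : (0 : ℝ) ≤ 3 / 4)]
          have hVV : V ^ (1 / 4 : ℝ) * V ^ (3 / 4 : ℝ) = V := by
            rw [← ENNReal.rpow_add_of_nonneg _ _ (by norm_num) (by norm_num)]; norm_num
          calc C₁ * ENNReal.ofReal (M * ρ) ^ (1 / 2 : ℝ) *
                (V ^ (1 / 4 : ℝ) * E ^ (1 / 4 : ℝ) * (V ^ (3 / 4 : ℝ) * (D + (ENNReal.ofReal (ρ ^ 2))⁻¹ * E) ^ (3 / 4 : ℝ)))
              = (V ^ (1 / 4 : ℝ) * V ^ (3 / 4 : ℝ)) * (C₁ * ENNReal.ofReal (M * ρ) ^ (1 / 2 : ℝ) * E ^ (1 / 4 : ℝ) *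
                  (D + (ENNReal.ofReal (ρ ^ 2))⁻¹ * E) ^ (3 / 4 : ℝ)) := by ring
            _ = _ := by rw [hVV]
  exact (ENNReal.mul_le_mul_iff_right hV0 hVt).1 h4

end Summit.NavierStokesRegularity.NavierStokesRegularity.Theorems.L3TimeExponentPincerMorreyOneScaleSlice

end
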